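import Literature.NumberTheory.Sieve.FriableMoebiusRootSumMainSumTwo
import Literature.NumberTheory.Sieve.FriableMoebiusRootSumIdentity
import Literature.NumberTheory.Sieve.BuchstabFunction
import HarnessLib

/-!
# The friable Möbius–root sum: the prime terms of the inductive step

Topic `Literature/NumberTheory/Sieve` (input of `FriableMoebiusRootSumStep.lean`). Everything here is
PROVED; no definitions, no named facts. Write `ρ = ρ_g`, `w(n) = μ(n)ρ(n)/n`,
`G(x, y) = ∑_{d ∈ smoothNumbersUpTo ⌊x⌋ ⌈y⌉} w(d)`, `R(v) = ∑_{n ≤ v} w(n) log(v/n)`, `ω` = Buchstab's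
function, `L = log x`, `u = L/log y`. The inductive hypothesis `P(k, C)` of the friable Möbius–root
law is

`|G(X, Y) − C_g ω(log X/log Y)/log Y − (R(X/Y) − C_g)/log Y| ≤ C/log² Y`  (`2 ≤ Y ≤ X`, `log X ≤ k log Y`).

* `abs_primeSum_friableSum_sub_main_le` — on the Buchstab range of primes `y ≤ p < z = x^{1/k}`
  (realised as `⌊a⌋ < p ≤ ⌊b⌋`), `P(k, C)` at the points `(x/p, p)`, the boundary-layer bound
  `|R(v) − C_g| ≤ C_B/(1 + log v)²`, the two error sums of `…PrimeSums` and the main sum of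
  `…MainSumTwo` give
  `|∑_p (ρ(p)/p) G(x/p, p) − C_g (u ω(u) − k ω(k))/L| ≤ ((C + C_B)(1/2 + 3C_E) + |C_g| K_main)/log² a`,
  `K_main = (2 + (k+3)³) C_E + 12 + 4k`.

## References

* G. Tenenbaum, *Introduction to analytic and probabilistic number theory*, Ch. III.6. [Tenenbaum2015]
-/

open Finset Real Polynomial

noncomputable section

namespace Literature.NumberTheory.Sieve

namespace FriableMoebiusRoot

/-- **The prime terms of the inductive step.** See the module docstring. [cite: Tenenbaum2015, Ch. III.6] -/
theorem abs_primeSum_friableSum_sub_main_le {g : ℤ[X]} {b₀ CE C CB : ℝ} (hC : 0 ≤ C) (hCB : 0 ≤ CB)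
    (hM : ∀ t : ℝ, 2 ≤ t → |∑ p ∈ Nat.primesLE ⌊t⌋₊, (polyRootCountMod ![g] p : ℝ) / p -
      (Real.log (Real.log t) + b₀)| ≤ CE / Real.log t ^ 2)
    {k : ℕ} (hk : 2 ≤ k)
    (hP : ∀ X Y : ℝ, 2 ≤ Y → Y ≤ X → Real.log X ≤ k * Real.log Y →
      |(∑ d ∈ Nat.smoothNumbersUpTo ⌊X⌋₊ ⌈Y⌉₊,
          (ArithmeticFunction.moebius d : ℝ) * (polyRootCountMod ![g] d : ℝ) / d) -
        batemanHornConst ![g] * buchstabOmega (Real.log X / Real.log Y) / Real.log Y -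
        ((∑ n ∈ Icc 1 ⌊X / Y⌋₊, (ArithmeticFunction.moebius n : ℝ) * (polyRootCountMod ![g] n : ℝ) / n *
            Real.log (X / Y / n)) - batemanHornConst ![g]) / Real.log Y| ≤ C / Real.log Y ^ 2)
    (hBL : ∀ v : ℝ, 1 ≤ v →
      |(∑ n ∈ Icc 1 ⌊v⌋₊, (ArithmeticFunction.moebius n : ℝ) * (polyRootCountMod ![g] n : ℝ) / n *
          Real.log (v / n)) - batemanHornConst ![g]| ≤ CB / (1 + Real.log v) ^ 2)
    {x y z a b : ℝ} (ha : Real.exp 1 ≤ a) (hay : a ≤ y) (hya : y ≤ a + 1)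
    (hab : a ≤ b) (hbz : b < z) (hzb : z ≤ b + 1) (hx : 0 < x) (hz : Real.log z = Real.log x / k)
    (hu : (k : ℝ) ≤ Real.log x / Real.log y) (hxy : Real.log x ≤ (k + 1) * Real.log y)
    (hxa : Real.log x ≤ 2 * (k + 1) * Real.log a)
    (hpy : ∀ p ∈ (Finset.Ioc ⌊a⌋₊ ⌊b⌋₊).filter Nat.Prime, y ≤ (p : ℝ))
    (hpx : ∀ p ∈ (Finset.Ioc ⌊a⌋₊ ⌊b⌋₊).filter Nat.Prime, (p : ℝ) ^ 2 ≤ x)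
    (hxp : ∀ p ∈ (Finset.Ioc ⌊a⌋₊ ⌊b⌋₊).filter Nat.Prime, Real.log x ≤ (k + 1) * Real.log p) :
    |∑ p ∈ (Finset.Ioc ⌊a⌋₊ ⌊b⌋₊).filter Nat.Prime, (polyRootCountMod ![g] p : ℝ) / p *
        ∑ d ∈ Nat.smoothNumbersUpTo (⌊x⌋₊ / p) p,
          (ArithmeticFunction.moebius d : ℝ) * (polyRootCountMod ![g] d : ℝ) / d -
      batemanHornConst ![g] * (1 / Real.log x * (Real.log x / Real.log y *
        buchstabOmega (Real.log x / Real.log y) - k * buchstabOmega k))| ≤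
      ((C + CB) * (1 / 2 + 3 * CE) + |batemanHornConst ![g]| * ((2 + (k + 3) ^ 3) * CE + 12 + 4 * k)) /
        Real.log a ^ 2 := by
  set S := (Finset.Ioc ⌊a⌋₊ ⌊b⌋₊).filter Nat.Prime with hS
  set L := Real.log x with hL
  set Cg := batemanHornConst ![g] with hCg
  set w : ℕ → ℝ := fun n => (ArithmeticFunction.moebius n : ℝ) * (polyRootCountMod ![g] n : ℝ) / n with hw
  set ρ : ℕ → ℝ := fun p => (polyRootCountMod ![g] p : ℝ) with hρ
  -- numerics
  have hk2 : (2 : ℝ) ≤ k := by exact_mod_cast hk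
  have ha0 : 0 < a := (Real.exp_pos 1).trans_le ha
  have hla1 : 1 ≤ Real.log a := by rw [Real.le_log_iff_exp_le ha0]; exact ha
  have hla : 0 < Real.log a := by linarith
  have hy0 : 0 < y := ha0.trans_le hay
  have hb0 : 0 < b := ha0.trans_le hab
  have hlay : Real.log a ≤ Real.log y := Real.log_le_log ha0 hay
  have hly : 0 < Real.log y := by linarith
  have hLy : (k : ℝ) * Real.log y ≤ L := by rwa [le_div_iff₀ hly] at hu
  have hL0 : 0 < L := by nlinarith
  have hlbz : Real.log b < Real.log z := Real.log_lt_log hb0 hbz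
  have hbL : 2 * Real.log b ≤ L := by
    have h1 : Real.log z ≤ L / 2 := by
      rw [hz]; exact div_le_div_of_nonneg_left hL0.le (by norm_num) hk2
    linarith
  have hbx : b < x := by
    by_contra h
    push Not at h
    have := Real.log_le_log hx h
    have hlb : 0 < Real.log b := by linarith [Real.log_le_log ha0 hab]
    linarith
  -- per prime: `P(k, C)` at `(x/p, p)` and the boundary-layer bound
  have hper : ∀ p ∈ S,
      |(∑ d ∈ Nat.smoothNumbersUpTo (⌊x⌋₊ / p) p, w d) -
        Cg * (buchstabOmega (L / Real.log p - 1) / Real.log p)| ≤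
        C / (p * Real.log p ^ 2) * p + CB / Real.log a * (1 / (1 + L - 2 * Real.log p) ^ 2) := by
    intro p hp
    have hpp : p.Prime := (Finset.mem_filter.mp hp).2
    have hp0 : (0 : ℝ) < p := by exact_mod_cast hpp.pos
    have hp2 : (2 : ℝ) ≤ p := by exact_mod_cast hpp.two_le
    have hyp : y ≤ p := hpy p hp
    have hlp : Real.log a ≤ Real.log p := hlay.trans (Real.log_le_log hy0 hyp)
    have hlp0 : 0 < Real.log p := by linarith
    have hp2x : (p : ℝ) ^ 2 ≤ x := hpx p hp
    -- the hypothesis at `(x/p, p)`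
    have h1 : (p : ℝ) ≤ x / p := by rw [le_div_iff₀ hp0]; nlinarith
    have h2 : Real.log (x / p) ≤ k * Real.log p := by
      rw [Real.log_div hx.ne' hp0.ne']; have := hxp p hp; linarith
    have hPp := hP (x / p) p hp2 h1 h2
    have hfl : ⌊x / p⌋₊ = ⌊x⌋₊ / p := Nat.floor_div_natCast x p
    have hce : ⌈(p : ℝ)⌉₊ = p := Nat.ceil_natCast p
    have hlog : Real.log (x / p) / Real.log p = L / Real.log p - 1 := by
      rw [Real.log_div hx.ne' hp0.ne']; field_simp; rfl
    rw [hfl, hce, hlog] at hPp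
    -- the boundary-layer term
    have hv : 1 ≤ x / p / p := by rw [le_div_iff₀ hp0, one_mul]; exact h1
    have hBLp := hBL (x / p / p) hv
    have hlv : Real.log (x / p / p) = L - 2 * Real.log p := by
      rw [Real.log_div (by positivity) hp0.ne', Real.log_div hx.ne' hp0.ne']; ring
    rw [hlv] at hBLp
    have hD : 1 ≤ 1 + L - 2 * Real.log p := by
      have : 2 * Real.log p ≤ L := by
        have := Real.log_le_log (by positivity) hp2x
        rw [Real.log_pow] at this; push_cast at this; linarith
      linarith
    have hBLp' : |((∑ n ∈ Icc 1 ⌊x / p / p⌋₊, w n * Real.log (x / p / p / n)) - Cg) / Real.log p| ≤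
        CB / Real.log a * (1 / (1 + L - 2 * Real.log p) ^ 2) := by
      rw [abs_div, abs_of_pos hlp0]
      calc |(∑ n ∈ Icc 1 ⌊x / p / p⌋₊, w n * Real.log (x / p / p / n)) - Cg| / Real.log p
          ≤ (CB / (1 + (L - 2 * Real.log p)) ^ 2) / Real.log a := by
            refine div_le_div₀ (by positivity) hBLp hla hlp
        _ = CB / Real.log a * (1 / (1 + L - 2 * Real.log p) ^ 2) := by
            rw [show 1 + (L - 2 * Real.log p) = 1 + L - 2 * Real.log p by ring]
            field_simp
    have hCp : C / Real.log p ^ 2 = C / (p * Real.log p ^ 2) * p := by field_simp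
    have htri := abs_sub_le ((∑ d ∈ Nat.smoothNumbersUpTo (⌊x⌋₊ / p) p, w d) -
        Cg * (buchstabOmega (L / Real.log p - 1) / Real.log p))
      (((∑ n ∈ Icc 1 ⌊x / p / p⌋₊, w n * Real.log (x / p / p / n)) - Cg) / Real.log p) 0
    simp only [sub_zero] at htri
    have hPp' : |(∑ d ∈ Nat.smoothNumbersUpTo (⌊x⌋₊ / p) p, w d) -
        Cg * (buchstabOmega (L / Real.log p - 1) / Real.log p) -
        ((∑ n ∈ Icc 1 ⌊x / p / p⌋₊, w n * Real.log (x / p / p / n)) - Cg) / Real.log p| ≤ C / Real.log p ^ 2 := by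
      simpa only [hw, mul_div_assoc] using hPp
    rw [hCp] at hPp'
    linarith
  -- sum the per-prime bounds
  have hsum1 : |∑ p ∈ S, ρ p / p * (∑ d ∈ Nat.smoothNumbersUpTo (⌊x⌋₊ / p) p, w d) -
      Cg * ∑ p ∈ S, ρ p / p * (buchstabOmega (L / Real.log p - 1) / Real.log p)| ≤
      C * ((1 / 2 + 3 * CE) / Real.log a ^ 2) + CB / Real.log a * ((1 / 2 + 3 * CE) / Real.log a) := by
    rw [Finset.mul_sum, ← Finset.sum_sub_distrib]
    have hps1 := sum_prime_div_mul_log_sq_le hM ha hab hbx (r := ρ)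
    have hps2 := sum_prime_boundaryLayer_le hM ha hab hx hbL (r := ρ)
    calc |∑ p ∈ S, (ρ p / p * (∑ d ∈ Nat.smoothNumbersUpTo (⌊x⌋₊ / p) p, w d) -
          Cg * (ρ p / p * (buchstabOmega (L / Real.log p - 1) / Real.log p)))|
        ≤ ∑ p ∈ S, |ρ p / p * (∑ d ∈ Nat.smoothNumbersUpTo (⌊x⌋₊ / p) p, w d) -
          Cg * (ρ p / p * (buchstabOmega (L / Real.log p - 1) / Real.log p))| := Finset.abs_sum_le_sum_abs _ _
      _ ≤ ∑ p ∈ S, ρ p / p * (C / (p * Real.log p ^ 2) * p + CB / Real.log a * (1 / (1 + L - 2 * Real.log p) ^ 2)) := by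
          refine Finset.sum_le_sum fun p hp => ?_
          have hρ0 : 0 ≤ ρ p / p := by positivity
          rw [show ρ p / p * (∑ d ∈ Nat.smoothNumbersUpTo (⌊x⌋₊ / p) p, w d) -
            Cg * (ρ p / p * (buchstabOmega (L / Real.log p - 1) / Real.log p)) =
            ρ p / p * ((∑ d ∈ Nat.smoothNumbersUpTo (⌊x⌋₊ / p) p, w d) -
              Cg * (buchstabOmega (L / Real.log p - 1) / Real.log p)) by ring, abs_mul, abs_of_nonneg hρ0]
          exact mul_le_mul_of_nonneg_left (hper p hp) hρ0
      _ = C * ∑ p ∈ S, ρ p / (p * Real.log p ^ 2) +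
          CB / Real.log a * ∑ p ∈ S, ρ p / p * (1 / (1 + L - 2 * Real.log p) ^ 2) := by
          rw [Finset.mul_sum, Finset.mul_sum, ← Finset.sum_add_distrib]
          refine Finset.sum_congr rfl fun p hp => ?_
          have hp0 : (0 : ℝ) < p := by exact_mod_cast (Finset.mem_filter.mp hp).2.pos
          field_simp
      _ ≤ C * ((1 / 2 + 3 * CE) / Real.log a ^ 2) + CB / Real.log a * ((1 / 2 + 3 * CE) / Real.log a) :=
          add_le_add (mul_le_mul_of_nonneg_left hps1 hC) (mul_le_mul_of_nonneg_left hps2 (by positivity))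
  -- the main sum
  have hmain := abs_sum_prime_buchstabWeight_sub_main_le hM hk ha hay hya hab hbz hzb hx hz hu hxy hxa hpy (r := ρ)
  have hsum2 : |Cg * ∑ p ∈ S, ρ p / p * (buchstabOmega (L / Real.log p - 1) / Real.log p) -
      Cg * (1 / L * (L / Real.log y * buchstabOmega (L / Real.log y) - k * buchstabOmega k))| ≤
      |Cg| * (((2 + (k + 3) ^ 3) * CE + 12 + 4 * k) / Real.log a ^ 2) := by
    rw [← mul_sub, abs_mul]
    exact mul_le_mul_of_nonneg_left hmain (abs_nonneg _)
  have htri := abs_sub_le (∑ p ∈ S, ρ p / p * (∑ d ∈ Nat.smoothNumbersUpTo (⌊x⌋₊ / p) p, w d))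
    (Cg * ∑ p ∈ S, ρ p / p * (buchstabOmega (L / Real.log p - 1) / Real.log p))
    (Cg * (1 / L * (L / Real.log y * buchstabOmega (L / Real.log y) - k * buchstabOmega k)))
  have hsplit : ((C + CB) * (1 / 2 + 3 * CE) + |Cg| * ((2 + (k + 3) ^ 3) * CE + 12 + 4 * k)) / Real.log a ^ 2 =
      C * ((1 / 2 + 3 * CE) / Real.log a ^ 2) + CB * ((1 / 2 + 3 * CE) / Real.log a ^ 2) +
        |Cg| * (((2 + (k + 3) ^ 3) * CE + 12 + 4 * k) / Real.log a ^ 2) := by ring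
  have hCE : 0 ≤ CE := mertensConst_nonneg hM
  have hconv : CB / Real.log a * ((1 / 2 + 3 * CE) / Real.log a) ≤ CB * ((1 / 2 + 3 * CE) / Real.log a ^ 2) := by
    rw [show CB / Real.log a * ((1 / 2 + 3 * CE) / Real.log a) = CB * ((1 / 2 + 3 * CE) / Real.log a ^ 2) by
      field_simp]
  rw [hsplit]
  linarith

end FriableMoebiusRoot

end Literature.NumberTheory.Sieve
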